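import Mathlib

/-!
# Route GeneratorObstructions — crux K2 `PowGenDegreeQP` (stmt-ValiantsHypothesis-11655), line
# `trace-side-regimes`: the arithmetic kernel of the tableau certificate for the doubling gadget

Companion of `…PowGenDegreeQPDoublingGadgetWindow` (`not_powGenDegreeQP_of_canonicalGadgetGIT`: K2 is
false once ONE highest-weight vector of nonconstant weight of `ℂ[Δ_{5k} g]` does not vanish at the
canonical doubling gadget `g`, `k = 2^t`).  The explicit candidate is a TABLEAU highest-weight vector
(tree: `TableauEval.TabM.tabPoly`, `tabPoly_mem_highestWeightSpace`); its value at `g` factorises over the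
`c` gadget blocks, and each block factor is, up to the nonzero factor `((3k)!/(k!)^3) · (k!(2k)!(2k)!)^3`,
the **Dixon sum** `E(k) = ∑_{a=0}^{2k} (-1)^a · C(2k,a)^3` (signed count of the Eulerian orientations of
the `2k`-fold triangle).  Dixon's identity `E(k) = (-1)^k (3k)!/(k!)^3` is classical; for the gadget only
`k = 2^t` is needed, and there the nonvanishing is elementary:

* `eight_dvd_choose_two_pow_cube` — for `0 < a < 2^(t+1)`, `8 ∣ C(2^(t+1), a)^3` (Kummer: the binomial
  is even, Mathlib `Nat.Prime.dvd_choose_pow_iff`);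
* `dixonSum_two_pow_emod_eight` — `E(2^t) % 8 = 2` (only the two end terms `a = 0`, `a = 2k` survive
  mod `8`);
* `dixonSum_two_pow_ne_zero` — hence `E(2^t) ≠ 0`.

Honest framing: an elementary arithmetic lemma serving an explicit-HWV certificate (blueprint in the
item's evidence memo `evidence-11655-leafhand3-g5.md`); no stub, crux or summit is settled here;
`VP ≠ VNP` untouched. [folklore]
-/

namespace Summit.ValiantsHypothesis.ValiantsHypothesis.Theorems.GeneratorObstructions.PowGenDegreeQP

-- `Summit.ValiantsHypothesis.ValiantsHypothesis.…` is the tree's mandated single-conjunct layout.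
set_option linter.dupNamespace false

open Finset

/-- Kummer at the prime `2`: for `0 < a < 2^(t+1)` the binomial coefficient `C(2^(t+1), a)` is even,
so its cube is divisible by `8` (as an integer). [folklore] -/
theorem eight_dvd_choose_two_pow_cube (t a : ℕ) (ha0 : a ≠ 0) (ha : a ≠ 2 ^ (t + 1)) :
    (8 : ℤ) ∣ ((2 ^ (t + 1)).choose a : ℤ) ^ 3 := by
  have h2 : 2 ∣ (2 ^ (t + 1)).choose a := (Nat.prime_two.dvd_choose_pow_iff).mpr ⟨ha0, ha⟩
  obtain ⟨q, hq⟩ := h2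
  refine ⟨(q : ℤ) ^ 3, ?_⟩
  rw [hq]
  push_cast
  ring

/-- Every middle term of the Dixon sum at `k = 2^t` is divisible by `8`. [folklore] -/
theorem eight_dvd_dixon_middle_term (t a : ℕ) (ha0 : a ≠ 0) (ha : a ≠ 2 ^ (t + 1)) :
    (8 : ℤ) ∣ (-1 : ℤ) ^ a * ((2 ^ (t + 1)).choose a : ℤ) ^ 3 :=
  Dvd.dvd.mul_left (eight_dvd_choose_two_pow_cube t a ha0 ha) _

/-- **The Dixon sum at a power of two is `2 mod 8`**:
`(∑_{a=0}^{2k} (-1)^a C(2k,a)^3) % 8 = 2` for `k = 2^t` — only the end terms `a = 0` and `a = 2k`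
(both equal to `1`) survive modulo `8`. [folklore] -/
theorem dixonSum_two_pow_emod_eight (t : ℕ) :
    (∑ a ∈ range (2 * 2 ^ t + 1), (-1 : ℤ) ^ a * ((2 * 2 ^ t).choose a : ℤ) ^ 3) % 8 = 2 := by
  have hn : 2 * 2 ^ t = 2 ^ (t + 1) := by ring
  rw [hn]
  -- write `2^(t+1) = m + 2`
  have h2le : 2 ≤ 2 ^ (t + 1) := by
    calc (2 : ℕ) = 2 ^ 1 := by norm_num
      _ ≤ 2 ^ (t + 1) := Nat.pow_le_pow_right (by norm_num) (by omega)
  obtain ⟨m, hm⟩ : ∃ m, 2 ^ (t + 1) = m + 2 := ⟨2 ^ (t + 1) - 2, by omega⟩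
  -- peel off the last term `a = m + 2` and the first term `a = 0`
  have hsplit : ∑ a ∈ range (2 ^ (t + 1) + 1), (-1 : ℤ) ^ a * ((2 ^ (t + 1)).choose a : ℤ) ^ 3 =
      (-1 : ℤ) ^ 0 * ((2 ^ (t + 1)).choose 0 : ℤ) ^ 3 +
        (∑ a ∈ range (m + 1), (-1 : ℤ) ^ (a + 1) * ((2 ^ (t + 1)).choose (a + 1) : ℤ) ^ 3) +
        (-1 : ℤ) ^ (2 ^ (t + 1)) * ((2 ^ (t + 1)).choose (2 ^ (t + 1)) : ℤ) ^ 3 := by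
    rw [hm, Finset.sum_range_succ, Finset.sum_range_succ']
    ring
  have hmid : (8 : ℤ) ∣
      ∑ a ∈ range (m + 1), (-1 : ℤ) ^ (a + 1) * ((2 ^ (t + 1)).choose (a + 1) : ℤ) ^ 3 := by
    apply Finset.dvd_sum
    intro a ha
    rw [Finset.mem_range] at ha
    exact eight_dvd_dixon_middle_term t (a + 1) (Nat.succ_ne_zero a) (by omega)
  obtain ⟨S, hS⟩ := hmid
  have hev : Even (2 ^ (t + 1)) := ⟨2 ^ t, by ring⟩
  have hlast : (-1 : ℤ) ^ (2 ^ (t + 1)) = 1 := hev.neg_one_pow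
  rw [hsplit, hS, hlast, Nat.choose_zero_right, Nat.choose_self]
  simp only [pow_zero, Nat.cast_one, one_pow, mul_one]
  omega

/-- **The Dixon sum at a power of two does not vanish**: `∑_{a=0}^{2k} (-1)^a C(2k,a)^3 ≠ 0` for
`k = 2^t`. (Dixon's identity gives the value `(-1)^k (3k)!/(k!)^3` for every `k`; only the elementary
`2`-adic statement is needed for the doubling gadget, whose exponent parameter is `k = 2^t`.) [folklore] -/
theorem dixonSum_two_pow_ne_zero (t : ℕ) :
    (∑ a ∈ range (2 * 2 ^ t + 1), (-1 : ℤ) ^ a * ((2 * 2 ^ t).choose a : ℤ) ^ 3) ≠ 0 := by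
  intro h
  have h8 := dixonSum_two_pow_emod_eight t
  rw [h] at h8
  norm_num at h8

/-- The same nonvanishing read in any characteristic-zero ring with an integer cast (e.g. `ℂ`),
where the tableau certificate is evaluated. [folklore] -/
theorem dixonSum_two_pow_cast_ne_zero (R : Type*) [Ring R] [CharZero R] (t : ℕ) :
    ((∑ a ∈ range (2 * 2 ^ t + 1), (-1 : ℤ) ^ a * ((2 * 2 ^ t).choose a : ℤ) ^ 3 : ℤ) : R) ≠ 0 := by
  exact_mod_cast (Int.cast_ne_zero.mpr (dixonSum_two_pow_ne_zero t) : ((_ : ℤ) : R) ≠ 0)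

end Summit.ValiantsHypothesis.ValiantsHypothesis.Theorems.GeneratorObstructions.PowGenDegreeQP
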